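import Summits.HubbardSuperconductivity.HubbardSuperconductivity.Theorems.AnisotropyChordTransferFibre3FinNumVac

/-!
# Route `AnisotropyChord` / H0 rotor rung: FIN layer 3f — the SPLIT regime certificate (`N` and `S` as separate kernel facts with integer literals)

The kernel checks one `decide` DECLARATION at a time and there is an effective per-declaration work ceiling (measured: between the
`L = 16` and the `L = 17` row–column cell).  This layer splits the non-vacuous cell check into THREE declarations glued by integer
literals `σ, η` chosen by the prover's float mirror and VERIFIED by the kernel:
  `nOK L a b η`  : `0 < lo N` and `hi N ≤ η`   (`N = ‖Π⁰‖²`, table + one convolution),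
  `sOK L a b σ`  : `hi S ≤ σ`                 (`S = Σ Π⁰·C0fn`, tables + one convolution),
  `combOK L a b σ η` : positivity of the cell constants, `σ ≤ 0 < η`, and `3·b·η + σ·D ≤ lo(bound)·η`  (cheap),
so that `T⁺ = 3λ + S/N ≤ 3b/D + σ/η ≤ lo(bound)/D`.  Vacuous cells use the cheap branches of `…FinNumVac` (`vacOK`).  Cells are
triples `(point, σ, η)`; `cellsAll3`, `cellsLast3`, `mholeCheck6`; ★ `mHole_nonneg_of_cells6`.
Prover seat `hubbard-h0-rotor-p3` g4; helper for stmt-HubbardSuperconductivity-23918 (piece A of rung 19089; `--supports`, helper class).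
WHAT THIS IS NOT: nothing here proves superconductivity in the Hubbard model; soundness of a FIN certificate for the regime
clause of one conditional reduction. Tree imports only; no sorry.
-/

set_option linter.dupNamespace false
set_option autoImplicit false

noncomputable section

namespace Summit.HubbardSuperconductivity.HubbardSuperconductivity.Theorems.AnisotropyChord.Transfer.Fibre3

namespace FinCell

open scoped BigOperators
open Finset Hole2

variable (L : ℕ) [NeZero L]

/-! ## Layer 3f: definitions (computable, zero data) -/

/-- the cheap vacuity branches: momentum positivity and (numerator vacuity or `Δ`-vacuity). [folklore] -/
def vacOK (L : ℕ) (la lb : ℤ) : Bool :=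
  denCellPos L (cosTab L) la lb &&
    ((decide ((numIv L la lb).2 < 0) && decide (0 ≤ (G0Iv L la lb).1)) ||
      (decide (0 < (wIv L la lb).1) && decide (0 < (denIv L la lb).1) && decide ((deltaIv L la lb).2 < 0)))

/-- the cheap combination check with the literals `σ` (upper bound of `S·D`) and `η` (upper bound of `N·D`). [folklore] -/
def combOK (L : ℕ) (la lb σ η : ℤ) : Bool :=
  denCellPos L (cosTab L) la lb && decide (0 < (wIv L la lb).1) && decide (0 < (denIv L la lb).1) &&
    decide (σ ≤ 0) && decide (0 < η) && decide (3 * lb * η + σ * D ≤ (boundIv L).1 * η)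

/-- the `N` fact: `0 < lo N`, `hi N ≤ η`. [folklore] -/
def nOK (L : ℕ) (la lb η : ℤ) : Bool :=
  decide (0 < (NIv3 L (fTab4 L la lb)).1) && decide ((NIv3 L (fTab4 L la lb)).2 ≤ η)

/-- the `S` fact: `hi S ≤ σ`. [folklore] -/
def sOK (L : ℕ) (la lb σ : ℤ) : Bool :=
  decide ((SIv3 L (fTab4 L la lb) (cellOracle4 L la lb)).2 ≤ σ)

/-- one cell of the split certificate. [folklore] -/
def splitOK (L : ℕ) (la lb σ η : ℤ) : Bool :=
  vacOK L la lb || (combOK L la lb σ η && nOK L la lb η && sOK L la lb σ)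

/-- consecutive cells of a list of triples `(point, σ, η)` all pass (the literals belong to the left point). [folklore] -/
def cellsAll3 (ok : ℤ → ℤ → ℤ → ℤ → Bool) : List (ℤ × ℤ × ℤ) → Bool
  | [] => true
  | [_] => true
  | (a, σ, η) :: (b, σ', η') :: rest => ok a b σ η && cellsAll3 ok ((b, σ', η') :: rest)

/-- the last point of a triple list. [folklore] -/
def cellsLast3 : List (ℤ × ℤ × ℤ) → ℤ
  | [] => 0
  | [p] => p.1
  | _ :: p :: rest => cellsLast3 (p :: rest)

/-- the first point of a triple list (`1`, i.e. not `0`, for the empty list). [folklore] -/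
def cellsHead3 : List (ℤ × ℤ × ℤ) → ℤ
  | [] => 1
  | p :: _ => p.1

/-- ★ the split per-`L` certificate. [folklore] -/
def mholeCheck6 (L : ℕ) (cells : List (ℤ × ℤ × ℤ)) : Bool :=
  decide (cellsHead3 cells = 0) && decide (2 ≤ cells.length) && decide (lamTop L ≤ cellsLast3 cells)
    && cellsAll3 (splitOK L) cells

/-! ## The cover -/

variable {L}

omit [NeZero L] in
/-- a point of `[a, last]` lies in some `ok` cell of the triple list. [folklore] -/
theorem cover_all3 (ok : ℤ → ℤ → ℤ → ℤ → Bool) : ∀ (rest : List (ℤ × ℤ × ℤ)) (p q : ℤ × ℤ × ℤ) (x : ℝ),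
    cellsAll3 ok (p :: q :: rest) = true → (p.1 : ℝ) ≤ x → x ≤ ((cellsLast3 (p :: q :: rest) : ℤ) : ℝ) →
    ∃ c d σ η : ℤ, ok c d σ η = true ∧ (c : ℝ) ≤ x ∧ x ≤ (d : ℝ) := by
  intro rest
  induction rest with
  | nil =>
    intro p q x hok ha hb
    obtain ⟨a, σ, η⟩ := p
    obtain ⟨b, σ', η'⟩ := q
    unfold cellsAll3 at hok
    rw [Bool.and_eq_true] at hok
    unfold cellsLast3 cellsLast3 at hb
    exact ⟨a, b, σ, η, hok.1, ha, hb⟩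
  | cons r rest ih =>
    intro p q x hok ha hb
    obtain ⟨a, σ, η⟩ := p
    obtain ⟨b, σ', η'⟩ := q
    unfold cellsAll3 at hok
    rw [Bool.and_eq_true] at hok
    by_cases hxb : x ≤ (b : ℝ)
    · exact ⟨a, b, σ, η, hok.1, ha, hxb⟩
    · push Not at hxb
      have hb' : x ≤ ((cellsLast3 ((b, σ', η') :: r :: rest) : ℤ) : ℝ) := by
        unfold cellsLast3 at hb; exact hb
      exact ih (b, σ', η') r x hok.2 hxb.le hb'

/-! ## Soundness -/

/-- the literal arithmetic: `S·D ≤ σ ≤ 0`, `0 < N·D ≤ η`, `λ·D ≤ b`, `3bη + σD ≤ Bη` ⇒ `3λ + S/N ≤ B/D`. [folklore] -/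
theorem tplus_le_of_lits {S N lam B : ℝ} {σ η b : ℤ} (hD : 0 < ((D : ℤ) : ℝ))
    (hS : S * ((D : ℤ) : ℝ) ≤ (σ : ℝ)) (hσ : (σ : ℝ) ≤ 0) (hN0 : 0 < N) (hN : N * ((D : ℤ) : ℝ) ≤ (η : ℝ)) (hη : 0 < (η : ℝ))
    (hlam : lam * ((D : ℤ) : ℝ) ≤ (b : ℝ))
    (hcomb : 3 * (b : ℝ) * (η : ℝ) + (σ : ℝ) * ((D : ℤ) : ℝ) ≤ B * (η : ℝ)) :
    3 * lam + S / N ≤ B / ((D : ℤ) : ℝ) := by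
  set Dr : ℝ := ((D : ℤ) : ℝ) with hDr
  -- `S/N ≤ σ/η`
  have hS' : S ≤ (σ : ℝ) / Dr := by rw [le_div_iff₀ hD]; exact hS
  have h1 : S / N ≤ ((σ : ℝ) / Dr) / N := div_le_div_of_nonneg_right hS' hN0.le
  have hσD : (σ : ℝ) / Dr ≤ 0 := div_nonpos_of_nonpos_of_nonneg hσ hD.le
  have hNle : N ≤ (η : ℝ) / Dr := by rw [le_div_iff₀ hD]; exact hN
  have hM : 0 < (η : ℝ) / Dr := div_pos hη hD
  have h2 : ((σ : ℝ) / Dr) / N ≤ ((σ : ℝ) / Dr) / ((η : ℝ) / Dr) := by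
    rw [div_le_div_iff₀ hN0 hM]
    nlinarith
  have h3 : ((σ : ℝ) / Dr) / ((η : ℝ) / Dr) = (σ : ℝ) / (η : ℝ) := by
    field_simp
  have hSN : S / N ≤ (σ : ℝ) / (η : ℝ) := by linarith [h1, h2, h3.le, h3.ge]
  -- `3λ ≤ 3b/D`
  have hl : lam ≤ (b : ℝ) / Dr := by rw [le_div_iff₀ hD]; exact hlam
  -- combine
  have hc : 3 * ((b : ℝ) / Dr) + (σ : ℝ) / (η : ℝ) ≤ B / Dr := by
    have e : 3 * ((b : ℝ) / Dr) + (σ : ℝ) / (η : ℝ) = (3 * (b : ℝ) * (η : ℝ) + (σ : ℝ) * Dr) / (Dr * (η : ℝ)) := by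
      field_simp
    rw [e, div_le_div_iff₀ (mul_pos hD hη) hD]
    nlinarith
  linarith

variable (L)

/-- ★★ SOUNDNESS OF THE SPLIT CERTIFICATE: `mholeCheck6 L cells = true` ⇒ `0 ≤ mHole L Δ f` for every ground profile, every
`0 < Δ < 1` (`7 ≤ L`). [folklore] -/
theorem mHole_nonneg_of_cells6 (hL : 7 ≤ L) (cells : List (ℤ × ℤ × ℤ)) (hchk : mholeCheck6 L cells = true)
    {Δ : ℝ} (hΔ0 : 0 < Δ) (hΔ1 : Δ < 1) :
    ∀ lam2 : ℝ, ∀ f : Tor L → ℝ, IsGroundTwoMagnon L Δ lam2 f → 0 ≤ mHole L Δ f := by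
  refine forall_ground_of_window_7 L hL hΔ0.le hΔ1 (fun _ f => 0 ≤ mHole L Δ f) ?_
  intro lam2 f hf hlam0 hlamle
  have hD := D_pos
  unfold mholeCheck6 at hchk
  simp only [Bool.and_eq_true, decide_eq_true_eq] at hchk
  obtain ⟨⟨⟨hhead, hlen⟩, htop⟩, hok⟩ := hchk
  obtain ⟨p, q, rest, hcells⟩ : ∃ p q : ℤ × ℤ × ℤ, ∃ rest : List (ℤ × ℤ × ℤ), cells = p :: q :: rest := by
    match cells, hlen with
    | p :: q :: rest, _ => exact ⟨p, q, rest, rfl⟩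
  subst hcells
  have hp0 : p.1 = 0 := by unfold cellsHead3 at hhead; exact hhead
  set x : ℝ := lam2 * ((D : ℤ) : ℝ) with hx
  have hx0 : (p.1 : ℝ) ≤ x := by rw [hp0, hx]; push_cast; positivity
  have hxtop : x ≤ ((cellsLast3 (p :: q :: rest) : ℤ) : ℝ) :=
    (lam_mul_D_le_lamTop L (by omega) hlamle).trans (by exact_mod_cast htop)
  obtain ⟨c, d, σ, η, hcell, hcx, hxd⟩ := cover_all3 (splitOK L) rest p q x hok hx0 hxtop
  have hfe : f = groundF L lam2 := ground_eq_explicit L (by omega) hΔ0.le hΔ1 hf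
  have hΔe : Δ = deltaOfLam L lam2 := ground_delta_eq L (by omega) hΔ0.le hΔ1 hf
  have hf2 : IsTwoMagnon L Δ lam2 f := hf.1
  have hev : ∀ r : Tor L, f (-r) = f r := hf.2.1
  have hsw : ∀ r : Tor L, f (r.2, r.1) = f r := by
    intro r; rw [hfe]; exact groundF_swap lam2 r
  unfold splitOK at hcell
  rw [Bool.or_eq_true] at hcell
  rcases hcell with hvac | hmain
  · -- the cheap vacuity branches
    exfalso
    unfold vacOK at hvac
    simp only [Bool.and_eq_true, Bool.or_eq_true, decide_eq_true_eq] at hvac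
    obtain ⟨hpos, hcase⟩ := hvac
    rcases hcase with ⟨hnum, hG0⟩ | ⟨⟨hw, hden⟩, hdel⟩
    · exact vacuous_of_num_neg (by omega) hlam0 hcx hxd hpos hnum hG0 hΔ0 hΔ1 hΔe
    · have hgc : groundCellCheck L c d = true := by
        unfold groundCellCheck
        simp only [Bool.and_eq_true, decide_eq_true_eq]
        exact ⟨⟨hpos, hw⟩, hden⟩
      have hmd := mem_delta_cell L (by omega) hlam0 hcx hxd hgc
      rw [← hΔe] at hmd
      obtain ⟨_, hhi⟩ := hmd
      have : ((((deltaIv L c d).2 : ℤ)) : ℝ) < 0 := by exact_mod_cast hdel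
      nlinarith
  · -- the split main case
    unfold combOK nOK sOK at hmain
    simp only [Bool.and_eq_true, decide_eq_true_eq] at hmain
    obtain ⟨⟨⟨⟨⟨⟨⟨hpos, hw⟩, hden⟩, hσ⟩, hη⟩, hcomb⟩, ⟨hN0, hNη⟩⟩, hSσ⟩ := hmain
    have hgc : groundCellCheck L c d = true := by
      unfold groundCellCheck
      simp only [Bool.and_eq_true, decide_eq_true_eq]
      exact ⟨⟨hpos, hw⟩, hden⟩
    have htab : TabEncl L f (fTab4 L c d) := by
      rw [hfe]; exact tabEncl_fTab4 (by omega) hlam0 hcx hxd hgc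
    have horc : ∀ e1 e2 r1 r2 : ℕ, e1 < L → e2 < L → r1 < L → r2 < L →
        mem (Dgrad L f ((((e1 : ℕ) : ZMod L)), (((e2 : ℕ) : ZMod L))) ((((r1 : ℕ) : ZMod L)), (((r2 : ℕ) : ZMod L))))
          (cellOracle4 L c d e1 e2 r1 r2) := by
      rw [hfe]; exact mem_cellOracle4 (by omega) hlam0 hcx hxd hgc
    have mN : mem (PiNormSq L f) (NIv3 L (fTab4 L c d)) := mem_NIv3 htab
    have mS : mem (∑ cc : Cfg L, piR L f cc * C0fn L Δ lam2 f cc) (SIv3 L (fTab4 L c d) (cellOracle4 L c d)) :=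
      mem_SIv3 (by omega) hf2 hev hsw htab horc
    obtain ⟨hNlo, hNhi⟩ := mN
    obtain ⟨_, hShi⟩ := mS
    have hNpos : 0 < PiNormSq L f := by
      have : (0 : ℝ) < (((NIv3 L (fTab4 L c d)).1 : ℤ) : ℝ) := by exact_mod_cast hN0
      nlinarith
    have hNη' : PiNormSq L f * ((D : ℤ) : ℝ) ≤ (η : ℝ) :=
      hNhi.trans (by exact_mod_cast hNη)
    have hSσ' : (∑ cc : Cfg L, piR L f cc * C0fn L Δ lam2 f cc) * ((D : ℤ) : ℝ) ≤ (σ : ℝ) :=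
      hShi.trans (by exact_mod_cast hSσ)
    have hσ' : (σ : ℝ) ≤ 0 := by exact_mod_cast hσ
    have hη' : (0 : ℝ) < (η : ℝ) := by exact_mod_cast hη
    have hcomb' : 3 * (d : ℝ) * (η : ℝ) + (σ : ℝ) * ((D : ℤ) : ℝ) ≤ ((((boundIv L).1 : ℤ)) : ℝ) * (η : ℝ) := by
      have h := (Int.cast_le (R := ℝ)).mpr hcomb
      push_cast at h
      exact h
    have hS := sum_piR_C0fn L hf2
    have hTeq : Tplus L Δ f = 3 * lam2 + (∑ cc : Cfg L, piR L f cc * C0fn L Δ lam2 f cc) * (1 / PiNormSq L f) := by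
      rw [hS]; field_simp; ring
    have hT : Tplus L Δ f ≤ ((((boundIv L).1 : ℤ)) : ℝ) / ((D : ℤ) : ℝ) := by
      rw [hTeq, ← div_eq_mul_one_div]
      exact tplus_le_of_lits hD hSσ' hσ' hNpos hNη' hη' hxd hcomb'
    have mB := mem_bound L (by omega)
    obtain ⟨hBlo, _⟩ := mB
    have hB : ((((boundIv L).1 : ℤ)) : ℝ) / ((D : ℤ) : ℝ) ≤ eps1 L * (1 - 5 / (L : ℝ) ^ 2 + 6 / ((L : ℝ) ^ 2) ^ 2) / 2 := by
      rw [div_le_iff₀ hD]; exact hBlo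
    unfold mHole
    linarith

end FinCell

end Summit.HubbardSuperconductivity.HubbardSuperconductivity.Theorems.AnisotropyChord.Transfer.Fibre3

end
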